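import Summits.QuantumFields.YangMills.Theorems.BalabanUVNodesN21LocalAveragedRegularity
import Literature.MathematicalPhysics.QuantumFieldTheory.Balaban1983to89.Node00.DatumAvLayer

/-!
# DAG node N11 — [B7] PROPOSITION 2 (52) ⇒ (53) FOR THE AVERAGING OF RECORD, LOCAL AND UNIFORM IN THE NUMBER OF AVERAGINGS: regularity of the
# `j`-fold averages on a BOX-CLOSED FAMILY of plaquette sets from regularity of the fine field on the family's bottom set ONLY

HEADER — WORK-UNIT METADATA.  Cell `pub-ymgap`, YM-PLAN Track A (HUMAN RULING D-0062), seat `pub-ymgap-dag-n11-d` (g12; R134 fan-out seat N11 [B14], strategy s2),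
route `BalabanUVNodes`, item K1⁷ `StabilityBAtRecordR13SepCoPH` = stmt-QuantumFields-20542 (helper, `--kind proof --supports 20542 --as helper`, count-neutral).
[B7] = [Balaban1985Averaging], [III] = [Balaban1988Convergent].  Over `Literature/…/BlockAveragingEMLProp2` (the GLOBAL k-fold Proposition 2 `plaqSmall_iter_blockAvg_eml(_level)`,
`exists_levelSup`, `smallness_of_le_c2'`, `B7.ineq53_induction`) and dag-n21's `…N21LocalAveragedRegularity` (the LOCAL ONE-STEP Proposition 1
`dist1_plaqHol_avgFun_le_sharp_of_boxRegion` on n20-d's box regions `boxRegion (emb p′₋) ((d+4)L + 2)`).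

WHY THIS FILE (the reading line of N11's no-expansion 𝐓-step).  The junction hJ of p591971 ∕ `…SpaceTruncationChargedSep` asks, at a charged separated index, the TOP
clause «`χ_k(s₀)(W_k) ≠ 0 ⇒ W_k is (cR·ε_k)-regular on Γ_k`».  NODE 00's `χ_k` ([III] (2.17)) bounds the (2.16) minimiser `U_{k,□}(W_k)` by `ε_k·η_k²` on the plaquettes
INSIDE `□^∼` ONLY (n20-d `plaqSmallOn_ukBox_of_chiSeqOfRecord_ne_zero`), and `W_k = M^k(U_{k,□}(W_k))` on the cube tops (n20-d `iter_ukBox_eq_of_mem_bondsOf`, on the solvable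
set); the tree's k-fold Proposition 2 (`plaqSmall_iter_blockAvg_eml_level`) reads a GLOBAL bound on the fine field and therefore yields only the CLASS threshold `2εreg`
(n20-d `plaqSmallOn_of_solvable`), never `2ε_k`.  Print's Proposition 2 is LOCAL ([B7] p. 25 «the bound above depends on bounds for V(∂p) − 1 on Δ(p′)»).  This file
proves the LOCAL k-FOLD form: the (53) induction run on an arbitrary family of plaquette sets `S i ⊆ T^{(i)}` that is BOX-CLOSED DOWNWARD (every plaquette of
`S (i+1)` has n20-d's one-step box inside `S i`), from the bound on `S 0` alone — the averaging brick the top clause needs (with per-cube solvability, a K0 row, and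
`cR ≥ 2`; K0a's families pin `cR := 1`, located on the bus).

WHAT THIS FILE PROVES (0 `sorry`, 0 `def`; generic torus `P`, generic `SU(n)`).
* `exists_levelSupOn` — achieved level suprema over a family of plaquette SETS (the local twin of `exists_levelSup`).
* ★★ `plaqSmallOn_iter_blockAvg_eml_of_boxClosed` — [B7] Prop. 2 (52) ⇒ (53), LOCAL and k-uniform: for a box-closed family `S`, `|U(∂p) − 1| < α₀η²` on `S 0`
  (`η = L^{−k}`, `C₀(d)α₀ ≤ ⅓`, `2α₀ ≤ c′₂`) gives `|Ū^j(∂p′) − 1| < 2α₀(L^jη)²` on `S j` for every `j ≤ k` — the constants of the global theorem VERBATIM.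
* `plaqSmallOn_iter_blockAvg_eml_of_boxClosed_top` — the top level `j = k`: `< 2α₀` on `S k`.
* `plaqSmallOn_iter_avOfRecord_of_boxClosed(_top)` — the same at NODE 00's averaging of record `Node00.avOfRecord`.
(The global theorem is the case `S i = univ` — `fun _ _ _ _ => Set.subset_univ _` is box-closure — so nothing is lost; not restated, dedup lint.)

HONEST FRAMING.  Helper lane of K1⁷; a published estimate ([B7] Prop. 2) in its printed LOCAL form, proved for the averaging of record; nothing of [III] asserted; the
junction hJ is NOT discharged here (solvability of (2.16) on the χ-support is a K0 row; the cube geometry «tops of `□` box-close into `□^∼`» and `cR ≥ 2` are the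
consumer's).  N11 NOT discharged; K1⁷ NOT closed; counts unmoved (typed 28∕28 · discharged 5∕27).  One finite four-torus programme at fixed `ε = L^{−K}` — NOT ℝ⁴, NOT
OS, NOT a mass gap, NOT Clay.  No `sorry`, `axiom`, `def`, `instance`, `notation`.  Sources: [B7] Prop. 1 (51) p.25–26, Prop. 2 (52)–(54) p.26; [III] (2.10) p.256,
(2.16)–(2.17) p.257, p.267.
-/

noncomputable section

open scoped BigOperators Matrix.Norms.L2Operator

namespace Summit.QuantumFields.YangMills.Theorems.BalabanUVNodesN11LocalIteratedAveraging

open Literature.MathematicalPhysics.QuantumFieldTheory.Balaban1983to89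
open T4Continuum BlockAveraging AveragingRT ExpMeanLog BlockAveragingEMLProp2
open Summit.QuantumFields.YangMills.BalabanUVNodes.N20LCSAvgDominationRegion (boxRegion mem_boxRegion mem_boxRegion_of_corner)
open Summit.QuantumFields.YangMills.Theorems.N21LocalAveragedRegularity (dist1_plaqHol_avgFun_le_sharp_of_boxRegion)

variable {n : Type*} [Fintype n] [DecidableEq n] [Nonempty n] {P : Params}

/-! ## §1  Level suprema over a family of plaquette sets -/

/-- **ACHIEVED LEVEL SUPREMA OVER A FAMILY OF PLAQUETTE SETS** `S i ⊆ T^{(i)}` (`0` on an empty set): every plaquette of `S i` is below `a_i`, and `a_i` is below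
any strict uniform bound on `S i` — the local twin of `BlockAveragingEMLProp2.exists_levelSup`. [cite: Balaban1985Averaging, (53) p.26] -/
theorem exists_levelSupOn (S : (i : ℕ) → Set (Plaq P i)) (V : (i : ℕ) → GaugeField P i (Matrix.specialUnitaryGroup n ℂ)) :
    ∃ a : ℕ → ℝ, (∀ i, 0 ≤ a i) ∧ (∀ i (p : Plaq P i), p ∈ S i → dist1 (GaugeField.plaqHol (V i) p) ≤ a i) ∧
      ∀ i (B : ℝ), 0 < B → (∀ p : Plaq P i, p ∈ S i → dist1 (GaugeField.plaqHol (V i) p) < B) → a i < B := by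
  classical
  refine ⟨fun i => if h : ((Finset.univ : Finset (Plaq P i)).filter (· ∈ S i)).Nonempty then
      ((Finset.univ : Finset (Plaq P i)).filter (· ∈ S i)).sup' h (fun p => dist1 (GaugeField.plaqHol (V i) p)) else 0,
    fun i => ?_, fun i p hp => ?_, fun i B hB h => ?_⟩
  · dsimp only
    by_cases hne : ((Finset.univ : Finset (Plaq P i)).filter (· ∈ S i)).Nonempty
    · rw [dif_pos hne]
      obtain ⟨q₀, -, hq₀⟩ := Finset.exists_mem_eq_sup' hne fun p => dist1 (GaugeField.plaqHol (V i) p)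
      rw [hq₀]; exact GaugeGroup.dist1_nonneg _
    · rw [dif_neg hne]
  · dsimp only
    have hmem : p ∈ (Finset.univ : Finset (Plaq P i)).filter (· ∈ S i) := Finset.mem_filter.mpr ⟨Finset.mem_univ p, hp⟩
    have hne : ((Finset.univ : Finset (Plaq P i)).filter (· ∈ S i)).Nonempty := ⟨p, hmem⟩
    rw [dif_pos hne]
    exact Finset.le_sup' (fun p => dist1 (GaugeField.plaqHol (V i) p)) hmem
  · dsimp only
    by_cases hne : ((Finset.univ : Finset (Plaq P i)).filter (· ∈ S i)).Nonempty
    · rw [dif_pos hne]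
      obtain ⟨q₀, hq₀m, hq₀⟩ := Finset.exists_mem_eq_sup' hne fun p => dist1 (GaugeField.plaqHol (V i) p)
      rw [hq₀]; exact h q₀ (Finset.mem_filter.mp hq₀m).2
    · rw [dif_neg hne]; exact hB

/-! ## §2  Proposition 2 (52) ⇒ (53), local and uniform in the number of averagings -/

/-- **★★ [Balaban1985Averaging] PROPOSITION 2 (52) ⇒ (53) FOR THE AVERAGING OF RECORD, LOCAL AND UNIFORM IN `k`.**  Let `S i ⊆ T^{(i)}` be a family of plaquette sets,
BOX-CLOSED DOWNWARD: for `i < k`, every plaquette `p′ ∈ S (i+1)` has n20-d's one-step box `boxRegion (emb p′₋) ((d+4)L + 2)` inside `S i`.  If `|U(∂p) − 1| < α₀η²` for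
the plaquettes of `S 0` ONLY (`η = L^{−k}`), `C₀(d)α₀ ≤ ⅓` and `2α₀ ≤ c′₂ = 2δ_N∕((d+4)L)²`, then for every `j ≤ k` the `j`-fold average `Ū^j = Averaging.iter (blockAvg ℰp) j U`
satisfies `|Ū^j(∂p′) − 1| < 2α₀(L^jη)²` on `S j`.  Proof: the (53) induction `B7.ineq53_induction` on the level suprema OVER `S i`, each step fed by dag-n21's LOCAL Proposition 1
`dist1_plaqHol_avgFun_le_sharp_of_boxRegion` (no hypothesis on any plaquette outside the box); constants VERBATIM the global `plaqSmall_iter_blockAvg_eml_level`.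
[cite: Balaban1985Averaging, Prop. 1 (51) pp.25–26, Prop. 2 (52)–(53) p.26] -/
theorem plaqSmallOn_iter_blockAvg_eml_of_boxClosed (k : ℕ) (S : (i : ℕ) → Set (Plaq P i))
    (hS : ∀ i, i < k → ∀ p ∈ S (i + 1), (↑(boxRegion (emb p.src) ((P.d + 4) * P.L + 2)) : Set (Plaq P i)) ⊆ S i)
    {α₀ : ℝ} (hα : 0 < α₀) (hα3 : (143 * ((((P.d + 4 : ℕ) : ℝ)) ^ 2 / 4) ^ 2) * α₀ ≤ 1 / 3)
    (hα2 : 2 * α₀ ≤ 2 * deltaSU n / (((P.d + 4) * P.L : ℕ) : ℝ) ^ 2)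
    {U : GaugeField P 0 (Matrix.specialUnitaryGroup n ℂ)} (h52 : PlaqSmallOn (S 0) (α₀ * (((P.L : ℝ) ^ k)⁻¹) ^ 2) U)
    {j : ℕ} (hj : j ≤ k) :
    PlaqSmallOn (S j) (2 * α₀ * ((P.L : ℝ) ^ j * ((P.L : ℝ) ^ k)⁻¹) ^ 2) (Averaging.iter (fun _ => blockAvg (expMeanLogSU (n := n))) j U) := by
  obtain ⟨a, ha0, hale, halt⟩ := exists_levelSupOn S (fun i => Averaging.iter (fun _ => blockAvg (expMeanLogSU (n := n))) i U)
  have hL : (2 : ℝ) ≤ P.L := by exact_mod_cast P.hL.2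
  have hLpos : (0 : ℝ) < (P.L : ℝ) ^ k := by have := P.L_pos; positivity
  have hC₀ : (0 : ℝ) < 143 * ((((P.d + 4 : ℕ) : ℝ)) ^ 2 / 4) ^ 2 := by positivity
  have hind := B7.ineq53_induction (P.L : ℝ) (((P.L : ℝ) ^ k)⁻¹) α₀ (143 * ((((P.d + 4 : ℕ) : ℝ)) ^ 2 / 4) ^ 2)
    (2 * deltaSU n / (((P.d + 4) * P.L : ℕ) : ℝ) ^ 2) k a hL (inv_pos.mpr hLpos) (mul_inv_cancel₀ hLpos.ne').le hC₀ hα hα3 hα2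
    (halt 0 _ (by positivity) h52) ?_ j hj
  · intro p hp
    refine (hale j p hp).trans_lt (hind.trans_le ?_)
    set x : ℝ := ((P.L : ℝ) ^ j * ((P.L : ℝ) ^ k)⁻¹) ^ 2 with hx
    have hx0 : 0 ≤ x := by positivity
    have hx1 : x ≤ 1 := by
      rw [hx]
      have hjk : (P.L : ℝ) ^ j * ((P.L : ℝ) ^ k)⁻¹ ≤ 1 := by
        rw [mul_inv_le_iff₀ hLpos, one_mul]
        exact pow_le_pow_right₀ (by linarith) hj
      have h0 : 0 ≤ (P.L : ℝ) ^ j * ((P.L : ℝ) ^ k)⁻¹ := by positivity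
      nlinarith
    have hS2 := B7.geom_bracket_le_two _ (by positivity) (B7.prop2_ratio_lt_half _ α₀ (P.L : ℝ) hL (by positivity) hα3).le j
    have hCa : 0 ≤ 143 * ((((P.d + 4 : ℕ) : ℝ)) ^ 2 / 4) ^ 2 * (α₀ * x) ^ 2 := by positivity
    calc α₀ * x + 143 * ((((P.d + 4 : ℕ) : ℝ)) ^ 2 / 4) ^ 2 * (α₀ * x) ^ 2 *
          ∑ i ∈ Finset.range j, ((1 + 143 * ((((P.d + 4 : ℕ) : ℝ)) ^ 2 / 4) ^ 2 * α₀) ^ 2 / (P.L : ℝ) ^ 2) ^ i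
        ≤ α₀ * x + 143 * ((((P.d + 4 : ℕ) : ℝ)) ^ 2 / 4) ^ 2 * (α₀ * x) ^ 2 * 2 := by gcongr
      _ ≤ 2 * α₀ * x := by
          have hx2 : x * x ≤ x := by nlinarith
          have hαx : 0 ≤ α₀ * x := mul_nonneg hα.le hx0
          have h1 : (α₀ * x) ^ 2 ≤ (α₀ * x) * α₀ := by
            rw [show (α₀ * x) ^ 2 = α₀ * α₀ * (x * x) by ring, show α₀ * x * α₀ = α₀ * α₀ * x by ring]
            exact mul_le_mul_of_nonneg_left hx2 (by positivity)
          have h2 : 143 * ((((P.d + 4 : ℕ) : ℝ)) ^ 2 / 4) ^ 2 * (α₀ * x) ^ 2 * 2 ≤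
              143 * ((((P.d + 4 : ℕ) : ℝ)) ^ 2 / 4) ^ 2 * ((α₀ * x) * α₀) * 2 := by gcongr
          have h3 : 143 * ((((P.d + 4 : ℕ) : ℝ)) ^ 2 / 4) ^ 2 * ((α₀ * x) * α₀) * 2 =
              (143 * ((((P.d + 4 : ℕ) : ℝ)) ^ 2 / 4) ^ 2 * α₀) * (α₀ * x) * 2 := by ring
          rw [h3] at h2
          have h4 : (143 * ((((P.d + 4 : ℕ) : ℝ)) ^ 2 / 4) ^ 2 * α₀) * (α₀ * x) * 2 ≤ (1 / 3) * (α₀ * x) * 2 :=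
            mul_le_mul_of_nonneg_right (mul_le_mul_of_nonneg_right hα3 hαx) (by norm_num)
          nlinarith
  -- the (53) step on the box-closed family, by dag-n21's LOCAL Proposition 1
  intro i hi Q hQ hQc hai
  have hsm : ((((P.d + 4) * P.L : ℕ) : ℝ) ^ 2 / 4) * a i ≤ deltaSU n / 2 :=
    (mul_le_mul_of_nonneg_left (hai.le.trans hQc) (by positivity)).trans (smallness_of_le_c2' le_rfl)
  refine halt (i + 1) _ (by positivity) fun p hp => ?_
  have h1 := dist1_plaqHol_avgFun_le_sharp_of_boxRegion (n := n) (ha0 i) hsm p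
    (fun q hq => hale i q (hS i hi p hp (Finset.mem_coe.mpr hq)))
  refine (show dist1 (GaugeField.plaqHol (Averaging.iter (fun _ => blockAvg (expMeanLogSU (n := n))) (i + 1) U) p) ≤ _ from h1).trans_lt ?_
  have hL2 : (0 : ℝ) < (P.L : ℝ) ^ 2 := by have := P.L_pos; positivity
  have e1 : (P.L : ℝ) ^ 2 * a i < (P.L : ℝ) ^ 2 * Q := mul_lt_mul_of_pos_left hai hL2
  have e2 : (((((P.d + 4) * P.L : ℕ) : ℝ) ^ 2 / 4) * a i) ^ 2 ≤ (((((P.d + 4) * P.L : ℕ) : ℝ) ^ 2 / 4) * Q) ^ 2 := by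
    have := ha0 i
    gcongr
  have e3 : 143 * (((((P.d + 4) * P.L : ℕ) : ℝ) ^ 2 / 4) * Q) ^ 2 =
      (143 * ((((P.d + 4 : ℕ) : ℝ)) ^ 2 / 4) ^ 2) * ((P.L : ℝ) ^ 2 * Q) ^ 2 := by
    push_cast; ring
  nlinarith [mul_le_mul_of_nonneg_left e2 (show (0 : ℝ) ≤ 143 by norm_num)]

/-- **THE TOP LEVEL** (`j = k`, `(L^kη)² = 1`): `|Ū^k(∂p′) − 1| < 2α₀` on `S k`. [cite: Balaban1985Averaging, Prop. 2 (52)–(54) p.26] -/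
theorem plaqSmallOn_iter_blockAvg_eml_of_boxClosed_top (k : ℕ) (S : (i : ℕ) → Set (Plaq P i))
    (hS : ∀ i, i < k → ∀ p ∈ S (i + 1), (↑(boxRegion (emb p.src) ((P.d + 4) * P.L + 2)) : Set (Plaq P i)) ⊆ S i)
    {α₀ : ℝ} (hα : 0 < α₀) (hα3 : (143 * ((((P.d + 4 : ℕ) : ℝ)) ^ 2 / 4) ^ 2) * α₀ ≤ 1 / 3)
    (hα2 : 2 * α₀ ≤ 2 * deltaSU n / (((P.d + 4) * P.L : ℕ) : ℝ) ^ 2)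
    {U : GaugeField P 0 (Matrix.specialUnitaryGroup n ℂ)} (h52 : PlaqSmallOn (S 0) (α₀ * (((P.L : ℝ) ^ k)⁻¹) ^ 2) U) :
    PlaqSmallOn (S k) (2 * α₀) (Averaging.iter (fun _ => blockAvg (expMeanLogSU (n := n))) k U) := by
  have hLpos : (0 : ℝ) < (P.L : ℝ) ^ k := by have := P.L_pos; positivity
  have h := plaqSmallOn_iter_blockAvg_eml_of_boxClosed k S hS hα hα3 hα2 h52 le_rfl
  rwa [mul_inv_cancel₀ hLpos.ne', one_pow, mul_one] at h

/-- **IN THE `η`-CURRENCY of the (2.17) thresholds** (`η_k = P.eta k = L^{−k}`): `|U(∂p) − 1| < α₀·η_k²` on `S 0` gives `|Ū^j(∂p′) − 1| < 2α₀·(L^j η_k)²` on `S j`.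
[cite: Balaban1985Averaging, Prop. 2 (52)–(53) p.26; Balaban1988Convergent, (2.17) p.257] -/
theorem plaqSmallOn_iter_blockAvg_eml_of_boxClosed_eta (k : ℕ) (S : (i : ℕ) → Set (Plaq P i))
    (hS : ∀ i, i < k → ∀ p ∈ S (i + 1), (↑(boxRegion (emb p.src) ((P.d + 4) * P.L + 2)) : Set (Plaq P i)) ⊆ S i)
    {α₀ : ℝ} (hα : 0 < α₀) (hα3 : (143 * ((((P.d + 4 : ℕ) : ℝ)) ^ 2 / 4) ^ 2) * α₀ ≤ 1 / 3)
    (hα2 : 2 * α₀ ≤ 2 * deltaSU n / (((P.d + 4) * P.L : ℕ) : ℝ) ^ 2)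
    {U : GaugeField P 0 (Matrix.specialUnitaryGroup n ℂ)} (h52 : PlaqSmallOn (S 0) (α₀ * P.eta k ^ 2) U) {j : ℕ} (hj : j ≤ k) :
    PlaqSmallOn (S j) (2 * α₀ * ((P.L : ℝ) ^ j * P.eta k) ^ 2) (Averaging.iter (fun _ => blockAvg (expMeanLogSU (n := n))) j U) := by
  have h52' : PlaqSmallOn (S 0) (α₀ * (((P.L : ℝ) ^ k)⁻¹) ^ 2) U := by
    intro p hp; have := h52 p hp; rwa [Params.eta, inv_pow] at this
  intro p hp
  have := plaqSmallOn_iter_blockAvg_eml_of_boxClosed k S hS hα hα3 hα2 h52' hj p hp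
  rwa [Params.eta, inv_pow]

/-! ## §3  At NODE 00's averaging of record (`Node00.avOfRecord F N K = blockAvg ℰp` at every scale) -/

section Record

open Node00

variable (F : T4Family) (N : ℕ) [NeZero N]

/-- **(53) LOCAL AT THE AVERAGING OF RECORD, EVERY LEVEL `j ≤ k`** (the local twin of dag-n21-c's `N21AveragedDatumRegularity.plaqSmall_iter_avOfRecord_level`): for a
box-closed family `S` on the torus of record, `PlaqSmallOn (S 0) (α₀η_k²) U ⇒ PlaqSmallOn (S j) (2α₀(L^jη_k)²) (Averaging.iter (avOfRecord F N K) j U)`.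
[cite: Balaban1985Averaging, Prop. 2 (52)–(53) p.26; Balaban1988Convergent, (2.16)–(2.17) p.257] -/
theorem plaqSmallOn_iter_avOfRecord_of_boxClosed (K k : ℕ) (S : (i : ℕ) → Set (Plaq (F.P K) i))
    (hS : ∀ i, i < k → ∀ p ∈ S (i + 1), (↑(boxRegion (emb p.src) (((F.P K).d + 4) * (F.P K).L + 2)) : Set (Plaq (F.P K) i)) ⊆ S i)
    {α₀ : ℝ} (hα : 0 < α₀) (hα3 : (143 * (((((F.P K).d + 4 : ℕ) : ℝ)) ^ 2 / 4) ^ 2) * α₀ ≤ 1 / 3)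
    (hα2 : 2 * α₀ ≤ 2 * deltaSU (Fin N) / ((((F.P K).d + 4) * (F.P K).L : ℕ) : ℝ) ^ 2)
    {U : GaugeField (F.P K) 0 (SU N)} (h52 : PlaqSmallOn (S 0) (α₀ * (F.P K).eta k ^ 2) U) {j : ℕ} (hj : j ≤ k) :
    PlaqSmallOn (S j) (2 * α₀ * (((F.P K).L : ℝ) ^ j * (F.P K).eta k) ^ 2) (Averaging.iter (avOfRecord F N K) j U) :=
  plaqSmallOn_iter_blockAvg_eml_of_boxClosed_eta (n := Fin N) k S hS hα hα3 hα2 h52 hj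

/-- **THE TOP LEVEL AT THE AVERAGING OF RECORD**: `PlaqSmallOn (S 0) (α₀η_k²) U ⇒ PlaqSmallOn (S k) (2α₀) (M^k U)` — the form the (2.16) reading uses (`M^k(U_{k,□}(V)) = V` on the
cube tops, n20-d `iter_ukBox_eq_of_mem_bondsOf`). [cite: Balaban1985Averaging, Prop. 2 (52)–(54) p.26; Balaban1988Convergent, (2.16)–(2.17) p.257, p.267] -/
theorem plaqSmallOn_iter_avOfRecord_of_boxClosed_top (K k : ℕ) (S : (i : ℕ) → Set (Plaq (F.P K) i))
    (hS : ∀ i, i < k → ∀ p ∈ S (i + 1), (↑(boxRegion (emb p.src) (((F.P K).d + 4) * (F.P K).L + 2)) : Set (Plaq (F.P K) i)) ⊆ S i)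
    {α₀ : ℝ} (hα : 0 < α₀) (hα3 : (143 * (((((F.P K).d + 4 : ℕ) : ℝ)) ^ 2 / 4) ^ 2) * α₀ ≤ 1 / 3)
    (hα2 : 2 * α₀ ≤ 2 * deltaSU (Fin N) / ((((F.P K).d + 4) * (F.P K).L : ℕ) : ℝ) ^ 2)
    {U : GaugeField (F.P K) 0 (SU N)} (h52 : PlaqSmallOn (S 0) (α₀ * (F.P K).eta k ^ 2) U) :
    PlaqSmallOn (S k) (2 * α₀) (Averaging.iter (avOfRecord F N K) k U) := by
  have h := plaqSmallOn_iter_avOfRecord_of_boxClosed F N K k S hS hα hα3 hα2 h52 le_rfl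
  have hL : (((F.P K).L : ℝ) ^ k * (F.P K).eta k) ^ 2 = 1 := by
    have hLpos : (0 : ℝ) < ((F.P K).L : ℝ) ^ k := by have := (F.P K).L_pos; positivity
    rw [Params.eta, inv_pow, mul_inv_cancel₀ hLpos.ne', one_pow]
  rwa [hL, mul_one] at h

end Record

end Summit.QuantumFields.YangMills.Theorems.BalabanUVNodesN11LocalIteratedAveraging

end
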